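import Literature.AlgebraicGeometry.Resolution.PointBlowupShadeBoundaryFree
import Literature.AlgebraicGeometry.Resolution.PointBlowupNoConsecutiveJumps
import HarnessLib

/-!
# The first four point blow-ups from a boundary-free state at order `pᵉ`: at most one increase of
# the shade, and only at event 3

Topic: `Literature/AlgebraicGeometry/Resolution`. A corollary file (cell `res-hironaka`, D-0130 RESCUE,
menu M88 «growth bias e ≥ 2», engine seat res-D-pv-008) composing
`PointBlowupShadeBoundaryFree.lean` §1 (no increase at event 1 from `r = 0`), §4 (none at event 2,
necessary conditions at event 3) with the "no two consecutive jumps" theorem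
`PointBlowup.not_shadeIncreases_step_of_shadeIncreases_pow'` of `PointBlowupNoConsecutiveJumps.lean`
([HauserPerlega2019PRIMS, §3 Comment (f)]): along ANY chain of four point blow-ups read at points
where the order stays `≥ q = pᵉ` (`e ≥ 1`), starting from a cleaned state with no exceptional divisor,
the shade (residual order) increases at most once — at event 3 — and if it does, event 4 does not
increase it again. The cell's bed rows `bed:mohrise:*` (`q = 4, 9, 8, 25, 27`) attain this single rise
with Moh's full `+p^{e−1}` ([Moh1987, Stability Theorem]) and drop at event 4.

**Honest framing (D-0012/D-0089).** Statements about the typed point-blow-up model `Res.PointBlowup`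
(hypersurfaces `x^q + F(y)` of order `q = pᵉ`, point centres, cleaning by deletion of `q`-th powers);
derived by the cell from the cited theorems as typed in the tree; nothing of H. Hironaka's 2017
manuscript is asserted or used; no claim about resolution of singularities in positive characteristic.
-/
noncomputable section

open MvPolynomial Finset

namespace Literature.AlgebraicGeometry.Resolution

open Literature.AlgebraicGeometry.Resolution.Hauser2010

namespace PointBlowup

section Main

variable {σ : Type*} {K : Type*} [Field K] [Fintype σ] [DecidableEq σ] [DecidableEq K]
variable (p : ℕ) [hp : Fact p.Prime] [CharP K p]

/-! ## The first four point blow-ups from a boundary-free state: at most one increase, at event 3 -/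

omit [Fintype σ] [DecidableEq σ] [DecidableEq K] hp [CharP K p] in
/-- With no exceptional divisor (`r = 0`) the divisibility hypothesis `y^r ∣ F` is trivial
(private plumbing). [folklore] -/
private theorem r_le_of_r_eq_zero₄ (s : State σ K) (hr0 : s.r = 0) :
    ∀ d ∈ s.F.support, s.r ≤ d := fun d _ => by
  rw [hr0]; exact bot_le

/-- **An increase at event 3 forbids an increase at event 4** (boundary-free start `r = 0`, `q = pᵉ`,
orders `≥ q` along the chain): the state after the third blow-up is the step of a state at
which the shade increased, so `not_shadeIncreases_step_of_shadeIncreases_pow'` ("no two consecutive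
jumps") applies. Together with §1 and §4: in the first four point blow-ups from a boundary-free
point the shade rises AT MOST ONCE, and only at event 3. (Derived by the cell; the bed's `mohrise`
rows `q = 4, 9, 8, 25, 27` attain the single rise with Moh's full `+p^{e−1}` and drop at event 4.)
[cite: HauserPerlega2019PRIMS, §3 Comment (f)] [cite: Moh1987, Stability Theorem] -/
theorem not_shadeIncreases_fourth_step_of_third {e : ℕ} (s : State σ K) (hr0 : s.r = 0)
    {o : ℕ} (ho : ordZero s.F = o)
    (j₁ : σ) (b₁ : σ → K) (hb₁ : b₁ j₁ = 0) {o₁ : ℕ} (ho₁ : ordZero (step (p ^ e) j₁ b₁ s).F = o₁)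
    (j₂ : σ) (b₂ : σ → K) (hb₂ : b₂ j₂ = 0) {o₂ : ℕ}
    (ho₂ : ordZero (step (p ^ e) j₂ b₂ (step (p ^ e) j₁ b₁ s)).F = o₂) (hqo₂ : p ^ e ≤ o₂)
    (j₃ : σ) (b₃ : σ → K) (hb₃ : b₃ j₃ = 0)
    (hinc : ShadeIncreases (p ^ e) j₃ b₃ (step (p ^ e) j₂ b₂ (step (p ^ e) j₁ b₁ s)))
    (j₄ : σ) (b₄ : σ → K) (hb₄ : b₄ j₄ = 0)
    (hord : ((p ^ e : ℕ) : ℕ∞) ≤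
      ordZero (step (p ^ e) j₃ b₃ (step (p ^ e) j₂ b₂ (step (p ^ e) j₁ b₁ s))).F) :
    ¬ ShadeIncreases (p ^ e) j₄ b₄ (step (p ^ e) j₃ b₃ (step (p ^ e) j₂ b₂ (step (p ^ e) j₁ b₁ s))) := by
  classical
  set q := p ^ e with hq
  set s₁ := step q j₁ b₁ s with hs₁
  set s₂ := step q j₂ b₂ s₁ with hs₂
  have hr₁ : ∀ d ∈ s₁.F.support, s₁.r ≤ d :=
    newMult_le_of_mem_support_step q j₁ b₁ hb₁ s ho (r_le_of_r_eq_zero₄ s hr0)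
  have hclean₂ : deletePthPowers q s₂.F = s₂.F := deletePthPowers_step q j₂ b₂ s₁
  have hr₂ : ∀ d ∈ s₂.F.support, s₂.r ≤ d := newMult_le_of_mem_support_step q j₂ b₂ hb₂ s₁ ho₁ hr₁
  exact not_shadeIncreases_step_of_shadeIncreases_pow' p j₃ b₃ hb₃ s₂ hclean₂ ho₂ hqo₂ hr₂ hinc j₄ b₄ hb₄
    hord

/-- **At most one increase in the first four blow-ups from a boundary-free point, and only at event 3**
(`r = 0`, `q = pᵉ`, `e ≥ 1`, every dimension, every choice of charts and points at which the order stays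
`≥ q`): no increase at event 1 (`not_shadeIncreases_of_r_eq_zero`), none at event 2
(`not_shadeIncreases_second_step_of_r_eq_zero`), and an increase at event 3 excludes one at event 4
(`not_shadeIncreases_fourth_step_of_third`). (Derived by the cell.)
[cite: HauserPerlega2019PRIMS, §3 Theorem (2), (6), Comments (d), (f)] [cite: Moh1987, Stability Theorem] -/
theorem atMostOne_increase_first_four_steps {e : ℕ} (he : 1 ≤ e) (s : State σ K) (hr0 : s.r = 0)
    (hclean : deletePthPowers (p ^ e) s.F = s.F) {o : ℕ} (ho : ordZero s.F = o) (hqo : p ^ e ≤ o)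
    (j₁ : σ) (b₁ : σ → K) (hb₁ : b₁ j₁ = 0) {o₁ : ℕ} (ho₁ : ordZero (step (p ^ e) j₁ b₁ s).F = o₁)
    (hqo₁ : p ^ e ≤ o₁)
    (j₂ : σ) (b₂ : σ → K) (hb₂ : b₂ j₂ = 0) {o₂ : ℕ}
    (ho₂ : ordZero (step (p ^ e) j₂ b₂ (step (p ^ e) j₁ b₁ s)).F = o₂) (hqo₂ : p ^ e ≤ o₂)
    (j₃ : σ) (b₃ : σ → K) (hb₃ : b₃ j₃ = 0)
    (j₄ : σ) (b₄ : σ → K) (hb₄ : b₄ j₄ = 0)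
    (hord : ((p ^ e : ℕ) : ℕ∞) ≤
      ordZero (step (p ^ e) j₃ b₃ (step (p ^ e) j₂ b₂ (step (p ^ e) j₁ b₁ s))).F) :
    ¬ ShadeIncreases (p ^ e) j₁ b₁ s ∧
    ¬ ShadeIncreases (p ^ e) j₂ b₂ (step (p ^ e) j₁ b₁ s) ∧
    (ShadeIncreases (p ^ e) j₃ b₃ (step (p ^ e) j₂ b₂ (step (p ^ e) j₁ b₁ s)) →
      ¬ ShadeIncreases (p ^ e) j₄ b₄
        (step (p ^ e) j₃ b₃ (step (p ^ e) j₂ b₂ (step (p ^ e) j₁ b₁ s)))) :=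
  ⟨not_shadeIncreases_of_r_eq_zero p j₁ b₁ hb₁ s hclean ho hqo hr0,
    not_shadeIncreases_second_step_of_r_eq_zero p he j₁ b₁ hb₁ s ho hr0 j₂ b₂ hb₂ ho₁ hqo₁,
    fun hinc => not_shadeIncreases_fourth_step_of_third p s hr0 ho j₁ b₁ hb₁ ho₁ j₂ b₂ hb₂ ho₂ hqo₂
      j₃ b₃ hb₃ hinc j₄ b₄ hb₄ hord⟩

end Main

end PointBlowup

end Literature.AlgebraicGeometry.Resolution

end
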